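import Summits.QuantumFields.YangMills.Theorems.VirialFluxGapSectorWeightSmooth
import HarnessLib

/-!
# Route `VirialFluxGap` (YangMills): the glue item `TwistedEquipartitionGlue` (stmt-QuantumFields-24183) holds BY NAME

`TwistedEquipartitionGlue := SharpTwistedLaplace → ConvexTransport → LogSectorWeightConvex → TwistedEquipartition`
(planner ym-idea-4 g14, LINE g14-A, glued split of crux `TwistedEquipartition` stmt-QuantumFields-24142).

CONVEX TRANSPORT GLUE.  Given `ε > 0`, take `(K, q, C, a, β₁, L₁)` from `SharpTwistedLaplace` (v2: two-sided Laplace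
`|log W_z(L,x) − (12xL⁴ − 9L⁴·log x + C(L,z))| ≤ K·L^q/x` on `L ≤ x^a`), put `K' := max K 0`, `Q := |q| + 4`,
`a' := min (a/2) (1/(2Q))`, and apply `ConvexTransport` to `g(x) := log W_z(L,x,2L−1) − 12L⁴x` on `[β/2, 2β]` with
`D := 18L⁴`, `C := C(L,z)`, `η := 2K'·L^q/β`: every `x ∈ [β/2, 2β]` lies in the Laplace window once `β ≥ 4`
(`L ≤ β^{a'} ≤ β^{a/2} = (√β)^a ≤ (β/2)^a ≤ x^a`) and `β ≥ 2β₁`; convexity of `g` from `LogSectorWeightConvex` minus a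
linear map; differentiability from the landed `TT.SectorSmooth.differentiable_sectorWeight_one` / `sectorWeight_one_pos`
(item 24143 ✓).  Then `β·(log W_z)′(β) = 12βL⁴ + β g′(β) ≤ 12βL⁴ − 9L⁴ + 8√(ηD)` and
`ηD = 36K'·L^q·L⁴/β ≤ 36K'·β^{a'Q − 1} ≤ 36K'/√β ≤ min((ε/8)², 324)` for `β ≥ ((36K'+1)/min((ε/8)²,324))²`, which gives both
`8√(ηD) ≤ ε` and `η ≤ D` (`D² ≥ 324`).

HONEST FRAMING: glue bookkeeping (real analysis); the crux `SharpTwistedLaplace` (stmt-QuantumFields-24204) and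
`PeriodicSoftness` (24141) are OPEN, so `TwistedEquipartition` / the leaf `FluxSectorSuppression` are NOT proved here; the
line is DRAFT-by-design; no rung / summit statement is proved; the Yang–Mills mass gap is NOT proved.  THEOREMS ONLY
(0 `def`, 0 `sorry`), standard axioms.  References: [cite: Griffiths1964]; [cite: TomboulisYaffe1985].
-/

set_option autoImplicit false

noncomputable section

open Set
open Summit.QuantumFields.YangMills.Theorems.FemtoTransferGap.TT.SectorSmooth
  (differentiable_sectorWeight_one sectorWeight_one_pos)

namespace Summit.QuantumFields.YangMills.Theorems.VirialFluxGap.TwistedEquipartitionGlue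

/-- Window arithmetic: for `β ≥ 4`, `0 < a`, `β/2 ≤ x`: `β^(a/2) ≤ x^a` (because `√β ≤ β/2`). -/
theorem rpow_half_le_rpow_of_window {β a x : ℝ} (hβ : 4 ≤ β) (ha : 0 ≤ a) (hx : β / 2 ≤ x) :
    β ^ (a / 2) ≤ x ^ a := by
  have hβ0 : 0 ≤ β := by linarith
  have hs2 : 2 ≤ Real.sqrt β := by
    rw [show (2 : ℝ) = Real.sqrt 4 by rw [show (4:ℝ) = 2 ^ 2 by norm_num, Real.sqrt_sq (by norm_num)]]
    exact Real.sqrt_le_sqrt hβ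
  have hsq : Real.sqrt β ≤ β / 2 := by
    have h := Real.mul_self_sqrt hβ0
    nlinarith [Real.sqrt_nonneg β]
  calc β ^ (a / 2) = (β ^ ((1 : ℝ) / 2)) ^ a := by
        rw [← Real.rpow_mul hβ0]; congr 1; ring
    _ = (Real.sqrt β) ^ a := by rw [Real.sqrt_eq_rpow]
    _ ≤ (β / 2) ^ a := Real.rpow_le_rpow (Real.sqrt_nonneg _) hsq ha
    _ ≤ x ^ a := Real.rpow_le_rpow (by linarith) hx ha

/-- Window arithmetic: for `1 ≤ L ≤ β^{a'}`, `1 ≤ β`, `a'·(|q|+4) ≤ 1/2`:  `L^q · L⁴ / β ≤ β^(−1/2)`. -/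
theorem window_decay {β a' q : ℝ} {L : ℝ} (hβ : 1 ≤ β) (hL : 1 ≤ L) (hLa : L ≤ β ^ a')
    (hQ : a' * (|q| + 4) ≤ 1 / 2) :
    L ^ q * L ^ 4 / β ≤ β ^ (-(1 / 2 : ℝ)) := by
  have hβ0 : 0 < β := by linarith
  have hL0 : 0 ≤ L := by linarith
  have h1 : L ^ q ≤ β ^ (a' * |q|) := by
    calc L ^ q ≤ L ^ |q| := Real.rpow_le_rpow_of_exponent_le hL (le_abs_self q)
      _ ≤ (β ^ a') ^ |q| := Real.rpow_le_rpow hL0 hLa (abs_nonneg q)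
      _ = β ^ (a' * |q|) := by rw [← Real.rpow_mul hβ0.le]
  have h2 : L ^ 4 ≤ β ^ (a' * 4) := by
    calc L ^ 4 ≤ (β ^ a') ^ 4 := pow_le_pow_left₀ hL0 hLa 4
      _ = β ^ (a' * 4) := by
          rw [Real.rpow_mul hβ0.le]; norm_cast
  have h3 : L ^ q * L ^ 4 ≤ β ^ (a' * (|q| + 4)) := by
    calc L ^ q * L ^ 4 ≤ β ^ (a' * |q|) * β ^ (a' * 4) :=
          mul_le_mul h1 h2 (pow_nonneg hL0 4) (Real.rpow_nonneg hβ0.le _)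
      _ = β ^ (a' * (|q| + 4)) := by rw [← Real.rpow_add hβ0]; congr 1; ring
  calc L ^ q * L ^ 4 / β ≤ β ^ (a' * (|q| + 4)) / β := div_le_div_of_nonneg_right h3 hβ0.le
    _ = β ^ (a' * (|q| + 4) - 1) := by rw [Real.rpow_sub_one hβ0.ne']
    _ ≤ β ^ (-(1 / 2 : ℝ)) := Real.rpow_le_rpow_of_exponent_le hβ (by linarith)
set_option maxHeartbeats 400000 in
/-- ★★ **`TwistedEquipartitionGlue` holds** (item stmt-QuantumFields-24183 of route `VirialFluxGap`, BY NAME):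
`SharpTwistedLaplace → ConvexTransport → LogSectorWeightConvex → TwistedEquipartition`. [cite: Griffiths1964] -/
theorem twistedEquipartitionGlue_proof :
    Summit.QuantumFields.YangMills.Theses.VirialFluxGap.TwistedEquipartitionGlue := by
  intro hSharp hCT hConv ε hε
  obtain ⟨K, q, C, a, ha, β₁, L₁, hSharp⟩ := hSharp
  -- constants
  set K' : ℝ := max K 0 with hK'
  have hK'0 : 0 ≤ K' := le_max_right _ _
  have hKK' : K ≤ K' := le_max_left _ _
  set Q : ℝ := |q| + 4 with hQ
  have hQ0 : 0 < Q := by rw [hQ]; positivity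
  set a' : ℝ := min (a / 2) (1 / (2 * Q)) with ha'
  have ha'0 : 0 < a' := lt_min (by linarith) (by positivity)
  have ha'a : a' ≤ a / 2 := min_le_left _ _
  have ha'Q : a' * (|q| + 4) ≤ 1 / 2 := by
    have h : a' ≤ 1 / (2 * Q) := min_le_right _ _
    rw [← hQ]
    calc a' * Q ≤ 1 / (2 * Q) * Q := mul_le_mul_of_nonneg_right h hQ0.le
      _ = 1 / 2 := by field_simp
  set τ : ℝ := min ((ε / 8) ^ 2) 324 with hτ
  have hτ0 : 0 < τ := lt_min (by positivity) (by norm_num)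
  have hτε : τ ≤ (ε / 8) ^ 2 := min_le_left _ _
  have hτ324 : τ ≤ 324 := min_le_right _ _
  set M : ℝ := (36 * K' + 1) / τ with hM
  have hM0 : 0 < M := div_pos (by linarith) hτ0
  refine ⟨a', ha'0, max (max 4 (2 * β₁)) (M ^ 2), L₁, ?_⟩
  intro β hβ L _ hL hLa z hz
  -- unpack the thresholds
  have hβ4 : 4 ≤ β := le_trans (le_trans (le_max_left _ _) (le_max_left _ _)) hβ
  have hββ₁ : 2 * β₁ ≤ β := le_trans (le_trans (le_max_right _ _) (le_max_left _ _)) hβ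
  have hβM : M ^ 2 ≤ β := le_trans (le_max_right _ _) hβ
  have hβ1 : 1 ≤ β := by linarith
  have hβ0 : 0 < β := by linarith
  have hL1 : (1 : ℝ) ≤ (L : ℝ) := Nat.one_le_cast.mpr (NeZero.one_le)
  have hL0 : (0 : ℝ) < (L : ℝ) := by linarith
  -- the data of the convex transport
  set W : ℝ → ℝ := fun b : ℝ =>
    Summit.QuantumFields.YangMills.Theorems.FemtoTransferGap.TT.sectorWeight (L := L) b (2 * L - 1) z
      (fun _ _ => (1 : ℝ)) with hW
  set D : ℝ := 18 * (L : ℝ) ^ 4 with hD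
  have hD18 : 18 ≤ D := by
    have : (1 : ℝ) ≤ (L : ℝ) ^ 4 := one_le_pow₀ hL1
    rw [hD]; linarith
  have hD0 : 0 < D := by linarith
  set η : ℝ := 2 * K' * (L : ℝ) ^ q / β with hη
  have hLq0 : 0 < (L : ℝ) ^ q := Real.rpow_pos_of_pos hL0 q
  have hη0 : 0 ≤ η := by rw [hη]; positivity
  -- `η D ≤ 36 K' β^{-1/2} ≤ τ`
  have hdecay := window_decay (q := q) hβ1 hL1 hLa ha'Q
  have hsqrtM : M ≤ Real.sqrt β := by
    rw [show M = Real.sqrt (M ^ 2) by rw [Real.sqrt_sq hM0.le]]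
    exact Real.sqrt_le_sqrt hβM
  have hsqrt0 : 0 < Real.sqrt β := Real.sqrt_pos.mpr hβ0
  have hrpow : β ^ (-(1 / 2 : ℝ)) = (Real.sqrt β)⁻¹ := by
    rw [Real.rpow_neg hβ0.le, Real.sqrt_eq_rpow]
  have hinv : (Real.sqrt β)⁻¹ ≤ τ / (36 * K' + 1) := by
    rw [inv_le_comm₀ hsqrt0 (div_pos hτ0 (by linarith))]
    calc (τ / (36 * K' + 1))⁻¹ = M := by rw [hM, inv_div]
      _ ≤ Real.sqrt β := hsqrtM
  have hηD : η * D ≤ τ := by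
    have h1 : η * D = 36 * K' * ((L : ℝ) ^ q * (L : ℝ) ^ 4 / β) := by
      rw [hη, hD]; ring
    rw [h1]
    calc 36 * K' * ((L : ℝ) ^ q * (L : ℝ) ^ 4 / β) ≤ 36 * K' * (Real.sqrt β)⁻¹ := by
          rw [← hrpow]; exact mul_le_mul_of_nonneg_left hdecay (by positivity)
      _ ≤ 36 * K' * (τ / (36 * K' + 1)) := mul_le_mul_of_nonneg_left hinv (by positivity)
      _ ≤ τ := by
          rw [mul_div_assoc']
          rw [div_le_iff₀ (by linarith)]
          nlinarith
  have hηleD : η ≤ D := by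
    have h : η * D ≤ D * D := by nlinarith
    exact le_of_mul_le_mul_right h hD0
  -- the convex function `g = log W − 12 L⁴ x` on `[β/2, 2β]`
  set g : ℝ → ℝ := fun x => Real.log (W x) - 12 * (L : ℝ) ^ 4 * x with hg
  have hWdiff : Differentiable ℝ W := differentiable_sectorWeight_one (L := L) (2 * L - 1) z
  have hWpos : ∀ x, 0 < W x := fun x => sectorWeight_one_pos (L := L) x (2 * L - 1) z
  have hlogW : ∀ x, DifferentiableAt ℝ (fun y => Real.log (W y)) x := fun x =>
    ((hWdiff x).log (hWpos x).ne')
  have hlin : ∀ x, HasDerivAt (fun y : ℝ => 12 * (L : ℝ) ^ 4 * y) (12 * (L : ℝ) ^ 4) x := fun x => by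
    simpa using (hasDerivAt_id x).const_mul (12 * (L : ℝ) ^ 4)
  have hgderiv : HasDerivAt g (deriv (fun y => Real.log (W y)) β - 12 * (L : ℝ) ^ 4) β :=
    (hlogW β).hasDerivAt.sub (hlin β)
  have hgdiff : DifferentiableAt ℝ g β := hgderiv.differentiableAt
  have hgconv : ConvexOn ℝ (Icc (β / 2) (2 * β)) g := by
    have h1 : ConvexOn ℝ univ (fun y => Real.log (W y)) := hConv L (2 * L - 1) z
    have h2 : ConcaveOn ℝ univ (fun y : ℝ => 12 * (L : ℝ) ^ 4 * y) := by
      have := (concaveOn_id (𝕜 := ℝ) (convex_univ (E := ℝ))).smul (show (0 : ℝ) ≤ 12 * (L : ℝ) ^ 4 by positivity)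
      simpa using this
    exact (h1.sub h2).subset (subset_univ _) (convex_Icc _ _)
  -- the Laplace approximation on the window
  have happrox : ∀ x ∈ Icc (β / 2) (2 * β), |g x + D / 2 * Real.log x - C L z| ≤ η := by
    intro x hx
    have hxβ : β / 2 ≤ x := hx.1
    have hx0 : 0 < x := by linarith
    have hxβ₁ : β₁ ≤ x := by linarith
    have hxa : (L : ℝ) ≤ x ^ a := by
      calc (L : ℝ) ≤ β ^ a' := hLa
        _ ≤ β ^ (a / 2) := Real.rpow_le_rpow_of_exponent_le hβ1 ha'a
        _ ≤ x ^ a := rpow_half_le_rpow_of_window hβ4 ha.le hxβ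
    have h := hSharp x hxβ₁ L hL hxa z hz
    have hrw : g x + D / 2 * Real.log x - C L z =
        Real.log (W x) - (12 * x * (L : ℝ) ^ 4 - 9 * (L : ℝ) ^ 4 * Real.log x + C L z) := by
      rw [hg, hD]; ring
    rw [hrw]
    calc |Real.log (W x) - (12 * x * (L : ℝ) ^ 4 - 9 * (L : ℝ) ^ 4 * Real.log x + C L z)|
        ≤ K * (L : ℝ) ^ q / x := h
      _ ≤ K' * (L : ℝ) ^ q / x :=
          div_le_div_of_nonneg_right (mul_le_mul_of_nonneg_right hKK' hLq0.le) hx0.le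
      _ ≤ K' * (L : ℝ) ^ q / (β / 2) :=
          div_le_div_of_nonneg_left (by positivity) (by linarith) hxβ
      _ = η := by rw [hη]; field_simp
  -- convex transport
  have hct := hCT g D (C L z) η β hβ0 hD0 hη0 hηleD hgconv hgdiff happrox
  have hsqrt : 8 * Real.sqrt (η * D) ≤ ε := by
    have h1 : Real.sqrt (η * D) ≤ Real.sqrt ((ε / 8) ^ 2) := Real.sqrt_le_sqrt (hηD.trans hτε)
    rw [Real.sqrt_sq (by positivity)] at h1
    linarith
  have hderiv : deriv g β = deriv (fun y => Real.log (W y)) β - 12 * (L : ℝ) ^ 4 := hgderiv.deriv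
  rw [hderiv] at hct
  have h := (abs_le.mp hct).2
  have hgoal : β * deriv (fun y => Real.log (W y)) β ≤ 12 * β * (L : ℝ) ^ 4 - 9 * (L : ℝ) ^ 4 + ε := by
    have : β * (deriv (fun y => Real.log (W y)) β - 12 * (L : ℝ) ^ 4) + D / 2 ≤ ε := h.trans hsqrt
    rw [hD] at this
    nlinarith
  simpa [hW] using hgoal

end Summit.QuantumFields.YangMills.Theorems.VirialFluxGap.TwistedEquipartitionGlue

end
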